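import Summits.Ventures.Crystal3D.Theorems.StickyWulffConstantCoaxialWallLawTwinWord
import Summits.Ventures.Crystal3D.Theorems.StickyWulffConstantGenericWallFloorCommonSlots
import Summits.Ventures.Crystal3D.Theorems.StickyWulffConstantGenericWallFloorMixedDozenRules
import Summits.Ventures.Crystal3D.Theorems.StickyWulffConstantGenericWallFloorSealing
import HarnessLib

/-!
# The two frames of a co-axial twin pair: menu, mirror relation, and disjoint far slots

HONEST FRAMING. Part of the venture `Summits/Ventures/Crystal3D` (cell `crystal3d-full`), helper for the
crux `CoaxialWallLaw` (stmt-Ventures-19481) of `route-Ventures-StickyWulffConstant`, REGISTERED line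
`WallLedgerF` (planner cf-p1 gen 16), open stub `stub_coaxialTwoSlabAdhesion` (general fillings).  Brick 9 of
the FLUX-GAP architecture (memo F-FLUXGAP-ARCH §2): the concrete frame data fed to the abstract automaton
(`…CoaxialWallLawAutomaton`).  After 19481-p1's frame normalisation (`coaxial_frame_eq_fcc_of_one` /
`coaxial_frame_eq_fcc_of_neg_one`) the two grains of a co-axial twin pair are `L·Λ₀ + s₁` and
`(L∘R)·Λ₀ + s₂` with `R` the half-turn about `e₃`; this file records, for the frames `L` and `L∘R` and the
axis `±L e₃`:

* `slot_apply_two_cases` — a slot `w` of `Λ₀` has `w₂ ∈ {0, ±√(2/3)}`;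
* `inner_frame_axis`, `inner_twinFrame_axis` — `⟪L w, L e₃⟫ = ⟪(L∘R) w, L e₃⟫ = w₂` (MENU position);
* `twinFrame_neg_eq`, `frame_neg_eq` — the MIRROR relation `(L∘R)(−w) = L w − 2⟪L w, n⟫ n` and
  `L(−w) = (L∘R) w − 2⟪(L∘R) w, n⟫ n` for `n = ±L e₃` (since `R(−w) = w − 2 w₂ e₃`);
* `halfTurn_notMem_fccSlots` — `R u` is not a slot when `u₂ ≠ 0` (`‖u + R u‖² = 8/3 ∉ ℤ`), hence
  `frame_ne_twinFrame` : `L u ≠ (L∘R) w` and `(L∘R) u ≠ L w` for slots `u, w` with `u₂ ≠ 0` — the steep/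
  shallow designated slots of one class are never slots of the other class.

WHAT THIS IS NOT: not the stub; F-C1 not moved.
-/

noncomputable section

namespace Summit.Ventures.Crystal3D.Theorems

open Summit.Ventures.Crystal3D Finset
open Literature.MathematicalPhysics.StatisticalMechanics (barlowPos fccStacking constHagg barlowPos_apply_two)
open scoped InnerProductSpace

/-- A slot of `Λ₀` has third coordinate `0`, `√(2/3)` or `−√(2/3)`. -/
theorem slot_apply_two_cases {w : EuclideanSpace ℝ (Fin 3)} (hw : w ∈ fccSlots) :
    w 2 = 0 ∨ w 2 = Real.sqrt (2 / 3) ∨ w 2 = -Real.sqrt (2 / 3) := by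
  classical
  rw [fccSlots, mem_image] at hw
  obtain ⟨c, hc, rfl⟩ := hw
  rw [barlowPos_apply_two]
  simp only [fccSlotTriples, mem_insert, mem_singleton] at hc
  rcases hc with rfl | rfl | rfl | rfl | rfl | rfl | rfl | rfl | rfl | rfl | rfl | rfl <;> simp

/-- **Menu position of the axis for the frame `L`**: `⟪L w, L e₃⟫ = w₂`. -/
theorem inner_frame_axis (L : EuclideanSpace ℝ (Fin 3) ≃ₗᵢ[ℝ] EuclideanSpace ℝ (Fin 3))
    (w : EuclideanSpace ℝ (Fin 3)) :
    ⟪L w, L (EuclideanSpace.single (2 : Fin 3) (1 : ℝ))⟫_ℝ = w 2 := by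
  rw [LinearIsometryEquiv.inner_map_map, inner_single_two_one]

/-- **Menu position of the axis for the twin frame `L∘R`**: `⟪(L∘R) w, L e₃⟫ = w₂`. -/
theorem inner_twinFrame_axis (L : EuclideanSpace ℝ (Fin 3) ≃ₗᵢ[ℝ] EuclideanSpace ℝ (Fin 3))
    (w : EuclideanSpace ℝ (Fin 3)) :
    ⟪((ℝ ∙ EuclideanSpace.single (2 : Fin 3) (1 : ℝ)).reflection.trans L) w,
      L (EuclideanSpace.single (2 : Fin 3) (1 : ℝ))⟫_ℝ = w 2 := by
  rw [LinearIsometryEquiv.trans_apply, LinearIsometryEquiv.inner_map_map, inner_single_two_one]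
  exact (halfTurn_coord w).2.2

/-- The half-turn of `−w`: `R(−w) = w − 2 w₂ e₃`. -/
theorem halfTurn_neg_eq (w : EuclideanSpace ℝ (Fin 3)) :
    (ℝ ∙ EuclideanSpace.single (2 : Fin 3) (1 : ℝ)).reflection (-w) =
      w - (2 * w 2) • EuclideanSpace.single (2 : Fin 3) (1 : ℝ) := by
  rw [halfTurn_apply]
  simp only [PiLp.neg_apply, mul_neg, neg_smul, sub_neg_eq_add]
  abel

/-- **Mirror relation, twin frame from frame**: `(L∘R)(−w) = L w − 2⟪L w, n⟫ n` for `n = ±L e₃`. -/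
theorem twinFrame_neg_eq (L : EuclideanSpace ℝ (Fin 3) ≃ₗᵢ[ℝ] EuclideanSpace ℝ (Fin 3))
    {n : EuclideanSpace ℝ (Fin 3)}
    (hn : n = L (EuclideanSpace.single (2 : Fin 3) (1 : ℝ)) ∨ n = -L (EuclideanSpace.single (2 : Fin 3) (1 : ℝ)))
    (w : EuclideanSpace ℝ (Fin 3)) :
    ((ℝ ∙ EuclideanSpace.single (2 : Fin 3) (1 : ℝ)).reflection.trans L) (-w) = L w - (2 * ⟪L w, n⟫_ℝ) • n := by
  rw [LinearIsometryEquiv.trans_apply, halfTurn_neg_eq, map_sub, LinearIsometryEquiv.map_smul]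
  rcases hn with rfl | rfl
  · rw [inner_frame_axis]
  · rw [inner_neg_right, inner_frame_axis, smul_neg, mul_neg, neg_smul, neg_neg]

/-- **Mirror relation, frame from twin frame**: `L(−w) = (L∘R) w − 2⟪(L∘R) w, n⟫ n` for `n = ±L e₃`. -/
theorem frame_neg_eq (L : EuclideanSpace ℝ (Fin 3) ≃ₗᵢ[ℝ] EuclideanSpace ℝ (Fin 3))
    {n : EuclideanSpace ℝ (Fin 3)}
    (hn : n = L (EuclideanSpace.single (2 : Fin 3) (1 : ℝ)) ∨ n = -L (EuclideanSpace.single (2 : Fin 3) (1 : ℝ)))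
    (w : EuclideanSpace ℝ (Fin 3)) :
    L (-w) = ((ℝ ∙ EuclideanSpace.single (2 : Fin 3) (1 : ℝ)).reflection.trans L) w -
      (2 * ⟪((ℝ ∙ EuclideanSpace.single (2 : Fin 3) (1 : ℝ)).reflection.trans L) w, n⟫_ℝ) • n := by
  have key : ∀ m : EuclideanSpace ℝ (Fin 3), m = L (EuclideanSpace.single (2 : Fin 3) (1 : ℝ)) →
      L (-w) = ((ℝ ∙ EuclideanSpace.single (2 : Fin 3) (1 : ℝ)).reflection.trans L) w - (2 * w 2) • m := by
    intro m hm
    rw [hm, LinearIsometryEquiv.trans_apply, halfTurn_apply, map_sub, LinearIsometryEquiv.map_smul, map_neg]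
    abel
  rcases hn with rfl | rfl
  · rw [inner_twinFrame_axis]; exact key _ rfl
  · rw [inner_neg_right, inner_twinFrame_axis, smul_neg, mul_neg, neg_smul, neg_neg]; exact key _ rfl

/-- **The half-turn of a non-horizontal slot is not a slot** (`‖u + R u‖² = 4 u₂² = 8/3` is not an
integer, while sums of lattice vectors have integral squared norm). -/
theorem halfTurn_notMem_fccSlots {u : EuclideanSpace ℝ (Fin 3)} (hu : u ∈ fccSlots) (hu2 : u 2 ≠ 0) :
    (ℝ ∙ EuclideanSpace.single (2 : Fin 3) (1 : ℝ)).reflection u ∉ fccSlots := by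
  intro hR
  set e₃ := EuclideanSpace.single (2 : Fin 3) (1 : ℝ) with he₃
  have hsum : u + (ℝ ∙ e₃).reflection u = (2 * u 2) • e₃ := by
    rw [halfTurn_apply]; abel
  obtain ⟨m, hm⟩ := exists_int_norm_sq_of_mem_fcc
    (fcc_add_site_mem (mem_fcc_of_mem_fccSlots hu) (mem_fcc_of_mem_fccSlots hR))
  rw [hsum, norm_smul, mul_pow, he₃, PiLp.norm_single, norm_one, one_pow, mul_one, Real.norm_eq_abs,
    sq_abs] at hm
  have h23 : Real.sqrt (2 / 3) ^ 2 = 2 / 3 := Real.sq_sqrt (by norm_num)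
  have hu22 : u 2 ^ 2 = 2 / 3 := by
    rcases slot_apply_two_cases hu with h | h | h
    · exact absurd h hu2
    · rw [h, h23]
    · rw [h, neg_sq, h23]
  have h83 : (3 : ℝ) * m = 8 := by rw [← hm, mul_pow, hu22]; norm_num
  have h83' : (3 : ℤ) * m = 8 := by exact_mod_cast h83
  omega

/-- **Far slots of one class are not slots of the other class.**  For slots `u, w` with `u₂ ≠ 0`:
`L u ≠ (L∘R) w` and `(L∘R) u ≠ L w`. -/
theorem frame_ne_twinFrame (L : EuclideanSpace ℝ (Fin 3) ≃ₗᵢ[ℝ] EuclideanSpace ℝ (Fin 3))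
    {u w : EuclideanSpace ℝ (Fin 3)} (hu : u ∈ fccSlots) (hu2 : u 2 ≠ 0) (hw : w ∈ fccSlots) :
    L u ≠ ((ℝ ∙ EuclideanSpace.single (2 : Fin 3) (1 : ℝ)).reflection.trans L) w ∧
      ((ℝ ∙ EuclideanSpace.single (2 : Fin 3) (1 : ℝ)).reflection.trans L) u ≠ L w := by
  set R := (ℝ ∙ EuclideanSpace.single (2 : Fin 3) (1 : ℝ)).reflection with hR
  have hRR : ∀ x, R (R x) = x := fun x => by
    rw [hR]; exact Submodule.reflection_reflection _ x
  constructor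
  · intro h
    rw [LinearIsometryEquiv.trans_apply] at h
    have h1 : u = R w := L.injective h
    have h2 : R u = w := by rw [h1, hRR]
    exact halfTurn_notMem_fccSlots hu hu2 (h2 ▸ hw)
  · intro h
    rw [LinearIsometryEquiv.trans_apply] at h
    have h1 : R u = w := L.injective h
    exact halfTurn_notMem_fccSlots hu hu2 (h1 ▸ hw)

end Summit.Ventures.Crystal3D.Theorems

end
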